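import Literature.NumberTheory.Automorphic.LaurentCurveTangent
import Literature.NumberTheory.Automorphic.RootSpaceLine
import Literature.NumberTheory.Automorphic.LieCentralizerTorusHolds
import Mathlib.Algebra.Lie.Sl2
import HarnessLib

/-!
# The `𝔰𝔩₂`-triples `(h_α, e_α, f_α)` of the roots in `Lie(G)` (characteristic `0`)
(trunk T-AUTOMORPHIC, G25 AutomorphicL; Springer 7.3.5, 8.1.1–8.1.3, 8.1.8; Humphreys 8.3–8.4)

Towards the Lie-algebra form of the isomorphism theorem on the DAG of
`Literature.NumberTheory.Automorphic.chevalley_isomorphism` (step 1 of Springer 9.6.2,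
`chevalley_isomorphism_abstract`). For a root datum `P` of `(G, T)` (`IsRootDatumOf G T P eX eY`,
`RootData.lean`) each root `α_i` comes with an algebraic `φ_i : SL₂ → G` (root homomorphisms on the
unipotents, the coroot `α_i^∨` on the diagonal). With the differential `dφ_i` of
`SL2Differential.lean` and the Laurent calculus of `LaurentCurveTangent.lean` we define and study

* `IsRootDatumOf.rootSL2 h i` (a choice of `φ_i`), `rootE h i = dφ_i E`, `rootF h i = dφ_i F`,
  `rootH h i = dφ_i H` (definitions);
* **the `𝔰𝔩₂` relations** `[e_i, f_i] = h_i`, `[h_i, e_i] = 2 e_i`, `[h_i, f_i] = -2 f_i`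
  (`lie_rootE_rootF`, `lie_rootH_rootE`, `lie_rootH_rootF`; `dφ_i` is a Lie algebra homomorphism,
  Springer 4.4.9), `isSl2Triple_root` (Mathlib `IsSl2Triple` for the commutator bracket);
* memberships: `rootE_mem` (`e_i ∈ 𝔤_{α_i}`), `rootF_mem` (`f_i ∈ 𝔤_{-α_i}`),
  `rootH_mem_lieAlgebraGL` (`h_i ∈ Lie(T)`, the velocity of the coroot), non-vanishing
  (`rootE_ne_zero`, `rootF_ne_zero`, `rootH_ne_zero`);
* **`tangentDeriv_rootH`: `dχ_x (h_i) = ⟨x, α_i^∨⟩`** for every weight `x` (Springer 3.2.11 with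
  7.3.5: `χ_x ∘ α_i^∨ = (t ↦ t^{⟨x, α_i^∨⟩})`), whence **`lie_rootH_of_mem_weightSpaceGL`:
  `[h_i, M] = ⟨x, α_i^∨⟩ M` for `M ∈ (𝔤𝔩ₙ)_{χ_x}`** — in particular `[h_i, e_j] = ⟨α_j, α_i^∨⟩ e_j`
  (Humphreys 8.4, the Cartan integers);
* in characteristic `0` for `G` connected reductive, `T` a maximal torus (using `𝔤^T = Lie(T)`,
  `lieWeightSpace_one_le_lieAlgebraGL_holds`, and `dim 𝔤_α ≤ 1`, `RootSpaceLine.lean`):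
  `lieWeightSpace_root_eq_span` (`𝔤_{α_i} = k e_i`), `lieWeightSpace_neg_root_eq_span`
  (`𝔤_{-α_i} = k f_i`), `lieWeightSpace_one_eq` (`𝔤_0 = Lie(T)`),
  `lieWeightSpace_charOfWeight_eq_bot` (`𝔤_x = 0` for `x ≠ 0` not a root),
  `lie_mem_lieWeightSpace_charOfWeight` (`[𝔤_x, 𝔤_y] ⊆ 𝔤_{x+y}`), `lie_eq_zero_of_mem_lieAlgebraGL_torus'`
  (`Lie(T)` is abelian).

All proofs complete; no named facts.

## Mathlib

`IsSl2Triple` (`Mathlib.Algebra.Lie.Sl2`, with the commutator bracket `LieRing.ofAssociativeRing`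
activated locally), `Module.finrank`, `Submodule.span`. Mathlib has no algebraic groups; nothing
here duplicates a Mathlib or Literature declaration (searched `rootE`, `rootSL2`, `sl2Diff`,
`IsSl2Triple` + `lieAlgebraGL`).

## References

* [SpringerLAG1998] T. A. Springer, *Linear Algebraic Groups*, 2nd ed., Progress in Mathematics
  9, Birkhäuser (1998): 3.2.11, 4.4.9, 7.3.5, 8.1.1 (i), Cor. 8.1.2, 8.1.3, 8.1.8.
* [Humphreys1972] J. E. Humphreys, *Introduction to Lie Algebras and Representation Theory*,
  GTM 9, Springer (1972), §8.3–8.4.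
-/

noncomputable section

open scoped MatrixGroups IsMulCommutative
open Polynomial

namespace Literature.NumberTheory.Automorphic

variable {k : Type*} [Field k] {n : Type*} [Fintype n] [DecidableEq n]
variable {ι X Y : Type*} [AddCommGroup X] [AddCommGroup Y]
variable {G T : Subgroup (GL n k)} [IsMulCommutative ↥T]
variable {P : RootPairing ι ℤ X Y} {eX : Additive ↥(characterLattice T) ≃+ X}
  {eY : Additive ↥(cocharacterLattice T) ≃+ Y}

/-! ### The chosen `SL₂` of a root and its differential -/

section Defs

/-- A chosen algebraic `φ_i : SL₂ → G` realising the root `α_i` and the coroot `α_i^∨`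
(`IsRootDatumOf.exists_sl2Hom`; Springer 7.3.5, 8.1.8). [folklore] -/
def IsRootDatumOf.rootSL2 (h : IsRootDatumOf G T P eX eY) (i : ι) : SL(2, k) →* ↥G :=
  (h.exists_sl2Hom i).choose

/-- The defining properties of `rootSL2`. [folklore] -/
lemma IsRootDatumOf.rootSL2_spec (h : IsRootDatumOf G T P eX eY) (i : ι) :
    IsAlgebraicSL2Hom (h.rootSL2 i) ∧
      IsRootHom G T h.le (charOfWeight eX (P.root i)) ((h.rootSL2 i).comp unipotentUpperSL2) ∧
      IsRootHom G T h.le (charOfWeight eX (P.root i))⁻¹ ((h.rootSL2 i).comp unipotentLowerSL2) ∧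
      ∀ t : kˣ, h.rootSL2 i (diagSL2 t) = Subgroup.inclusion h.le (cocharOfCoweight eY (P.coroot i) t) :=
  (h.exists_sl2Hom i).choose_spec

/-- `φ_i` is algebraic. [folklore] -/
lemma IsRootDatumOf.isAlgebraicSL2Hom_rootSL2 (h : IsRootDatumOf G T P eX eY) (i : ι) :
    IsAlgebraicSL2Hom (h.rootSL2 i) := (h.rootSL2_spec i).1

/-- `φ_i ∘ u⁺` is a root homomorphism for `α_i`. [folklore] -/
lemma IsRootDatumOf.isRootHom_rootSL2_upper (h : IsRootDatumOf G T P eX eY) (i : ι) :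
    IsRootHom G T h.le (charOfWeight eX (P.root i)) ((h.rootSL2 i).comp unipotentUpperSL2) :=
  (h.rootSL2_spec i).2.1

/-- `φ_i ∘ u⁻` is a root homomorphism for `-α_i`. [folklore] -/
lemma IsRootDatumOf.isRootHom_rootSL2_lower (h : IsRootDatumOf G T P eX eY) (i : ι) :
    IsRootHom G T h.le (charOfWeight eX (P.root i))⁻¹ ((h.rootSL2 i).comp unipotentLowerSL2) :=
  (h.rootSL2_spec i).2.2.1

/-- `φ_i ∘ diag = α_i^∨`. [folklore] -/
lemma IsRootDatumOf.rootSL2_diagSL2 (h : IsRootDatumOf G T P eX eY) (i : ι) (t : kˣ) :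
    h.rootSL2 i (diagSL2 t) = Subgroup.inclusion h.le (cocharOfCoweight eY (P.coroot i) t) :=
  (h.rootSL2_spec i).2.2.2 t

/-- The root vector `e_i = dφ_i (E) ∈ 𝔤_{α_i}`. [folklore] -/
def IsRootDatumOf.rootE (h : IsRootDatumOf G T P eX eY) (i : ι) : Matrix n n k :=
  sl2Diff (h.isAlgebraicSL2Hom_rootSL2 i) slE

/-- The root vector `f_i = dφ_i (F) ∈ 𝔤_{-α_i}`. [folklore] -/
def IsRootDatumOf.rootF (h : IsRootDatumOf G T P eX eY) (i : ι) : Matrix n n k :=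
  sl2Diff (h.isAlgebraicSL2Hom_rootSL2 i) slF

/-- The coroot vector `h_i = dφ_i (H) ∈ Lie(T)` (the velocity of `α_i^∨`). [folklore] -/
def IsRootDatumOf.rootH (h : IsRootDatumOf G T P eX eY) (i : ι) : Matrix n n k :=
  sl2Diff (h.isAlgebraicSL2Hom_rootSL2 i) slH

end Defs

/-! ### The `𝔰𝔩₂` relations -/

section Relations

variable [Infinite k] (h : IsRootDatumOf G T P eX eY) (i : ι)

/-- `[e_i, f_i] = h_i`. [cite: SpringerLAG1998, 4.4.9] -/
theorem IsRootDatumOf.lie_rootE_rootF :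
    h.rootE i * h.rootF i - h.rootF i * h.rootE i = h.rootH i := by
  have key := sl2Diff_lie (h.isAlgebraicSL2Hom_rootSL2 i) qUpper qLower det_qUpper qUpper_coeff_zero
    det_qLower qLower_coeff_zero
  rw [qUpper_coeff_one, qLower_coeff_one, sl2_relations.1] at key
  exact key.symm

/-- `[h_i, e_i] = 2 e_i`. [cite: SpringerLAG1998, 4.4.9] -/
theorem IsRootDatumOf.lie_rootH_rootE :
    h.rootH i * h.rootE i - h.rootE i * h.rootH i = (2 : k) • h.rootE i := by
  set hφ := h.isAlgebraicSL2Hom_rootSL2 i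
  have key := sl2Diff_lie hφ qHEF qUpper det_qHEF qHEF_coeff_zero det_qUpper qUpper_coeff_zero
  rw [qHEF_coeff_one, qUpper_coeff_one] at key
  -- `(H + E - F) E - E (H + E - F) = 2E + H` in `𝔰𝔩₂`
  have hmat : ((slH + slE - slF) * slE - slE * (slH + slE - slF) : Matrix (Fin 2) (Fin 2) k) =
      (2 : k) • slE + slH := by
    ext a b; fin_cases a <;> fin_cases b <;> simp [slE, slF, slH]; norm_num
  rw [hmat, sl2Diff_add, sl2Diff_smul, sl2Diff_sub, sl2Diff_add] at key
  -- `key : 2 dφE + dφH = [dφH + dφE - dφF, dφE]`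
  have hEF := h.lie_rootE_rootF i
  change (2 : k) • h.rootE i + h.rootH i =
    (h.rootH i + h.rootE i - h.rootF i) * h.rootE i - h.rootE i * (h.rootH i + h.rootE i - h.rootF i)
    at key
  have e1 : (h.rootH i + h.rootE i - h.rootF i) * h.rootE i - h.rootE i * (h.rootH i + h.rootE i - h.rootF i)
      = (h.rootH i * h.rootE i - h.rootE i * h.rootH i) + (h.rootE i * h.rootF i - h.rootF i * h.rootE i) := by
    noncomm_ring
  rw [e1, hEF] at key
  -- `2E + H = [H, E] + H`
  have := congrArg (fun M => M - h.rootH i) key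
  simp only [add_sub_cancel_right] at this
  exact this.symm

/-- `[h_i, f_i] = -2 f_i`. [cite: SpringerLAG1998, 4.4.9] -/
theorem IsRootDatumOf.lie_rootH_rootF :
    h.rootH i * h.rootF i - h.rootF i * h.rootH i = -((2 : k) • h.rootF i) := by
  set hφ := h.isAlgebraicSL2Hom_rootSL2 i
  have key := sl2Diff_lie hφ qHEF qLower det_qHEF qHEF_coeff_zero det_qLower qLower_coeff_zero
  rw [qHEF_coeff_one, qLower_coeff_one] at key
  -- `(H + E - F) F - F (H + E - F) = -2F + H` in `𝔰𝔩₂`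
  have hmat : ((slH + slE - slF) * slF - slF * (slH + slE - slF) : Matrix (Fin 2) (Fin 2) k) =
      -((2 : k) • slF) + slH := by
    ext a b; fin_cases a <;> fin_cases b <;> simp [slE, slF, slH]; norm_num
  rw [hmat, sl2Diff_add, sl2Diff_neg, sl2Diff_smul, sl2Diff_sub, sl2Diff_add] at key
  have hEF := h.lie_rootE_rootF i
  change -((2 : k) • h.rootF i) + h.rootH i =
    (h.rootH i + h.rootE i - h.rootF i) * h.rootF i - h.rootF i * (h.rootH i + h.rootE i - h.rootF i)
    at key
  have e1 : (h.rootH i + h.rootE i - h.rootF i) * h.rootF i - h.rootF i * (h.rootH i + h.rootE i - h.rootF i)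
      = (h.rootH i * h.rootF i - h.rootF i * h.rootH i) + (h.rootE i * h.rootF i - h.rootF i * h.rootE i) := by
    noncomm_ring
  rw [e1, hEF] at key
  have := congrArg (fun M => M - h.rootH i) key
  simp only [add_sub_cancel_right] at this
  exact this.symm

/-! ### Memberships and the Cartan integers -/

/-- `e_i ∈ 𝔤_{α_i}`. [cite: SpringerLAG1998, 8.1.1 (i)] -/
theorem IsRootDatumOf.rootE_mem : h.rootE i ∈ lieWeightSpace G T (charOfWeight eX (P.root i)) := by
  refine ⟨?_, sl2Diff_slE_mem_weightSpaceGL _ (h.isRootHom_rootSL2_upper i)⟩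
  have := sl2Diff_mem_lieAlgebraGL (h.isAlgebraicSL2Hom_rootSL2 i) qUpper det_qUpper qUpper_coeff_zero
  rwa [qUpper_coeff_one] at this

/-- `f_i ∈ 𝔤_{-α_i}` (the weight space of `α_i⁻¹`). [cite: SpringerLAG1998, 8.1.1 (i)] -/
theorem IsRootDatumOf.rootF_mem : h.rootF i ∈ lieWeightSpace G T (charOfWeight eX (P.root i))⁻¹ := by
  refine ⟨?_, sl2Diff_slF_mem_weightSpaceGL _ (h.isRootHom_rootSL2_lower i)⟩
  have := sl2Diff_mem_lieAlgebraGL (h.isAlgebraicSL2Hom_rootSL2 i) qLower det_qLower qLower_coeff_zero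
  rwa [qLower_coeff_one] at this

/-- `f_i ∈ 𝔤_{-α_i}`, the weight space indexed by the weight `-α_i`. [folklore] -/
theorem IsRootDatumOf.rootF_mem' : h.rootF i ∈ lieWeightSpace G T (charOfWeight eX (-P.root i)) := by
  rw [charOfWeight_neg]; exact h.rootF_mem i

/-- **`h_i ∈ Lie(T)`**: `h_i = dφ_i (H)` is the velocity of the coroot `α_i^∨ = φ_i ∘ diag`, a curve
in `T` (`sl2Diff_slH_mem_lieAlgebraGL`). [cite: SpringerLAG1998, 4.4.9] -/
theorem IsRootDatumOf.rootH_mem_lieAlgebraGL : h.rootH i ∈ lieAlgebraGL T :=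
  sl2Diff_slH_mem_lieAlgebraGL _ fun t => by rw [h.rootSL2_diagSL2 i t]; exact (cocharOfCoweight eY _ t).2

/-- `h_i ∈ Lie(G)`. [folklore] -/
theorem IsRootDatumOf.rootH_mem_lieAlgebraGL' : h.rootH i ∈ lieAlgebraGL G :=
  lieAlgebraGL_mono h.le (h.rootH_mem_lieAlgebraGL i)

/-- **`dχ_x (h_i) = ⟨x, α_i^∨⟩`** for every weight `x ∈ X`: the differential at `1` of the character
`χ_x` (represented by the polynomial `p`) takes the value `⟨x, α_i^∨⟩` on the coroot vector,
because `χ_x (α_i^∨ (t)) = t ^ ⟨x, α_i^∨⟩` (Springer 3.2.11, 7.3.5). [cite: SpringerLAG1998, 3.2.11] -/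
theorem IsRootDatumOf.tangentDeriv_rootH (x : X) {p : MvPolynomial (GLCoord n) k}
    (hp : ∀ t : ↥T, ((charOfWeight eX x t : kˣ) : k) = MvPolynomial.eval (glCoordFun (t : GL n k)) p) :
    tangentDeriv p (h.rootH i) = P.toLinearMap x (P.coroot i) := by
  refine tangentDeriv_sl2Diff_slH (h.isAlgebraicSL2Hom_rootSL2 i) fun t => ?_
  rw [h.rootSL2_diagSL2 i t, Subgroup.coe_inclusion, ← hp, h.charOfWeight_cocharOfCoweight x _ t]

/-- **`[h_i, M] = ⟨x, α_i^∨⟩ M` for every weight vector `M ∈ (𝔤𝔩ₙ)_{χ_x}`** (differentiate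
`t M t⁻¹ = χ_x(t) M` along `α_i^∨`; Humphreys 8.4: the Cartan integers as eigenvalues of `ad h_α`).
[cite: Humphreys1972, 8.4] -/
theorem IsRootDatumOf.lie_rootH_of_mem_weightSpaceGL (x : X) {M : Matrix n n k}
    (hM : M ∈ weightSpaceGL T (charOfWeight eX x)) :
    h.rootH i * M - M * h.rootH i = ((P.toLinearMap x (P.coroot i) : ℤ) : k) • M := by
  obtain ⟨p, hp⟩ := (Additive.toMul (eX.symm x)).2
  have hp' : ∀ t : ↥T, ((charOfWeight eX x t : kˣ) : k) = MvPolynomial.eval (glCoordFun (t : GL n k)) p := hp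
  rw [lie_eq_tangentDeriv_smul_of_mem_weightSpaceGL hp' hM (h.rootH_mem_lieAlgebraGL i),
    h.tangentDeriv_rootH i x hp']

/-- `[h_i, e_j] = ⟨α_j, α_i^∨⟩ e_j` (the Cartan integers). [cite: Humphreys1972, 8.4] -/
theorem IsRootDatumOf.lie_rootH_rootE_eq (j : ι) :
    h.rootH i * h.rootE j - h.rootE j * h.rootH i = ((P.pairing j i : ℤ) : k) • h.rootE j := by
  rw [h.lie_rootH_of_mem_weightSpaceGL i (P.root j) (h.rootE_mem j).2, P.root_coroot_eq_pairing]

/-- `[h_i, f_j] = -⟨α_j, α_i^∨⟩ f_j`. [cite: Humphreys1972, 8.4] -/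
theorem IsRootDatumOf.lie_rootH_rootF_eq (j : ι) :
    h.rootH i * h.rootF j - h.rootF j * h.rootH i = -(((P.pairing j i : ℤ) : k) • h.rootF j) := by
  rw [h.lie_rootH_of_mem_weightSpaceGL i (-P.root j) (h.rootF_mem' j).2, map_neg, LinearMap.neg_apply,
    P.root_coroot_eq_pairing, Int.cast_neg, neg_smul]

/-- Elements of `Lie(T)` commute with `h_i`. [folklore] -/
theorem IsRootDatumOf.lie_rootH_eq_zero_of_mem_lieAlgebraGL_torus {H : Matrix n n k}
    (hH : H ∈ lieAlgebraGL T) : h.rootH i * H - H * h.rootH i = 0 :=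
  lie_eq_zero_of_mem_lieAlgebraGL_torus (h.rootH_mem_lieAlgebraGL i) hH

/-! ### Non-vanishing -/

/-- `e_i ≠ 0` (`φ_i ∘ u⁺` has a regular retraction). [cite: SpringerLAG1998, 8.1.1 (i)] -/
theorem IsRootDatumOf.rootE_ne_zero : h.rootE i ≠ 0 := by
  obtain ⟨r, hr⟩ := (h.isRootHom_rootSL2_upper i).2.1
  have := sl2Diff_ne_zero_of_retraction (h.isAlgebraicSL2Hom_rootSL2 i) qUpper det_qUpper
    qUpper_coeff_zero (r := r) fun x => by rw [curveSL2_qUpper]; exact hr x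
  rwa [qUpper_coeff_one] at this

/-- `f_i ≠ 0`. [cite: SpringerLAG1998, 8.1.1 (i)] -/
theorem IsRootDatumOf.rootF_ne_zero : h.rootF i ≠ 0 := by
  obtain ⟨r, hr⟩ := (h.isRootHom_rootSL2_lower i).2.1
  have := sl2Diff_ne_zero_of_retraction (h.isAlgebraicSL2Hom_rootSL2 i) qLower det_qLower
    qLower_coeff_zero (r := r) fun x => by rw [curveSL2_qLower]; exact hr x
  rwa [qLower_coeff_one] at this

/-- `h_i ≠ 0` (in characteristic `≠ 2`, here `0`): `[h_i, e_i] = 2 e_i ≠ 0`. [folklore] -/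
theorem IsRootDatumOf.rootH_ne_zero [CharZero k] : h.rootH i ≠ 0 := by
  intro h0
  have := h.lie_rootH_rootE i
  rw [h0, Matrix.zero_mul, Matrix.mul_zero, sub_zero] at this
  exact h.rootE_ne_zero i ((smul_eq_zero.mp this.symm).resolve_left two_ne_zero)

end Relations

/-! ### The triple as a Mathlib `IsSl2Triple` for the commutator bracket -/

section Sl2

attribute [local instance 100] LieRing.ofAssociativeRing

variable [Infinite k] [CharZero k] (h : IsRootDatumOf G T P eX eY) (i : ι)

/-- **`(h_i, e_i, f_i)` is an `𝔰𝔩₂`-triple** in the Lie algebra `𝔤𝔩ₙ` (commutator bracket).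
[cite: Humphreys1972, 8.3] -/
theorem IsRootDatumOf.isSl2Triple_root : IsSl2Triple (h.rootH i) (h.rootE i) (h.rootF i) where
  h_ne_zero := h.rootH_ne_zero i
  lie_e_f := by rw [Ring.lie_def]; exact h.lie_rootE_rootF i
  lie_h_e_nsmul := by rw [Ring.lie_def, h.lie_rootH_rootE i, ofNat_smul_eq_nsmul]
  lie_h_f_nsmul := by rw [Ring.lie_def, h.lie_rootH_rootF i, ofNat_smul_eq_nsmul]

end Sl2

/-! ### Root spaces are lines: consequences in a connected reductive group -/

section Reductive

variable [IsAlgClosed k] [CharZero k]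
variable (hG : IsConnectedReductive G) (hT : IsMaximalTorusIn T G) (h : IsRootDatumOf G T P eX eY)

include hG hT in
/-- `𝔤^T = Lie(T)` in characteristic `0` (packaging of `lieWeightSpace_one_le_lieAlgebraGL_holds`
and `lieAlgebraGL_le_lieWeightSpace_one`). [cite: SpringerLAG1998, 5.4.7 and 7.6.4 (ii)] -/
theorem lieWeightSpace_one_eq : lieWeightSpace G T 1 = lieAlgebraGL T :=
  le_antisymm (lieWeightSpace_one_le_lieAlgebraGL_holds G T hG hT)
    (lieAlgebraGL_le_lieWeightSpace_one hT.1)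

omit [IsMulCommutative ↥T] [IsAlgClosed k] [CharZero k] in
/-- `𝔤_{χ_0} = 𝔤^T` (`χ_0 = 1`). [folklore] -/
theorem lieWeightSpace_charOfWeight_zero_eq (eX : Additive ↥(characterLattice T) ≃+ X) :
    lieWeightSpace G T (charOfWeight eX 0) = lieWeightSpace G T 1 := by
  have : charOfWeight eX (0 : X) = 1 := by simp [charOfWeight]
  rw [this]

include hG hT in
/-- **`𝔤_{α_i} = k e_i`** (`dim 𝔤_α ≤ 1`, `finrank_lieWeightSpace_le_one_of_lieWeightSpace_one_le`,
and `e_i ≠ 0`). [cite: SpringerLAG1998, Cor. 8.1.2 and 8.1.3] -/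
theorem IsRootDatumOf.mem_lieWeightSpace_root_iff (i : ι) {M : Matrix n n k} :
    M ∈ lieWeightSpace G T (charOfWeight eX (P.root i)) ↔ ∃ c : k, M = c • h.rootE i := by
  constructor
  · intro hM
    exact exists_eq_smul_of_finrank_le_one
      (finrank_lieWeightSpace_le_one_of_lieWeightSpace_one_le hG hT
        (lieWeightSpace_one_le_lieAlgebraGL_holds G T hG hT) h i)
      (h.rootE_mem i) (h.rootE_ne_zero i) hM
  · rintro ⟨c, rfl⟩
    exact Submodule.smul_mem _ c (h.rootE_mem i)

include hG hT in
/-- **`𝔤_{-α_i} = k f_i`**. [cite: SpringerLAG1998, Cor. 8.1.2 and 8.1.3] -/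
theorem IsRootDatumOf.mem_lieWeightSpace_neg_root_iff (i : ι) {M : Matrix n n k} :
    M ∈ lieWeightSpace G T (charOfWeight eX (-P.root i)) ↔ ∃ c : k, M = c • h.rootF i := by
  -- `-α_i = α_{s_i i}` is a root, whose root space is a line containing `f_i ≠ 0`
  have hneg : -P.root i = P.root (P.reflectionPerm i i) := by
    rw [RootPairing.root_reflectionPerm, RootPairing.reflection_apply_self]
  constructor
  · intro hM
    rw [hneg] at hM
    have hF : h.rootF i ∈ lieWeightSpace G T (charOfWeight eX (P.root (P.reflectionPerm i i))) := by
      rw [← hneg]; exact h.rootF_mem' i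
    exact exists_eq_smul_of_finrank_le_one
      (finrank_lieWeightSpace_le_one_of_lieWeightSpace_one_le hG hT
        (lieWeightSpace_one_le_lieAlgebraGL_holds G T hG hT) h (P.reflectionPerm i i))
      hF (h.rootF_ne_zero i) hM
  · rintro ⟨c, rfl⟩
    exact Submodule.smul_mem _ c (h.rootF_mem' i)

omit [IsAlgClosed k] in
include hG hT h in
/-- **The weight space of a non-zero weight which is not a root vanishes** (in characteristic `0`
the non-zero weights of `T` on `Lie(G)` are exactly the roots, `lieWeights_eq_roots_of_charZero`).
[cite: SpringerLAG1998, Cor. 8.1.2] -/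
theorem IsRootDatumOf.lieWeightSpace_charOfWeight_eq_bot {x : X} (hx0 : x ≠ 0)
    (hx : x ∉ Set.range P.root) : lieWeightSpace G T (charOfWeight eX x) = ⊥ := by
  rw [Submodule.eq_bot_iff]
  intro M hM
  by_contra hM0
  set χ : ↥(characterLattice T) := Additive.toMul (eX.symm x) with hχ
  have hχ1 : (χ : ↥T →* kˣ) ≠ 1 := by
    intro h1
    apply hx0
    have : eX (Additive.ofMul χ) = x := by simp [hχ]
    rw [← this]
    have hone : χ = 1 := Subtype.ext h1
    rw [hone]; simp
  have hmem : χ ∈ lieWeights G T :=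
    mem_lieWeights_iff.2 ⟨hχ1, M, hM.1, hM0, hM.2⟩
  rw [lieWeights_eq_roots_of_charZero hG.1.1 hT.2.1.1 hT.1] at hmem
  apply hx
  have : eX (Additive.ofMul χ) ∈ Set.range P.root := by
    rw [h.range_root]; exact ⟨χ, hmem, rfl⟩
  simpa [hχ] using this

omit [IsMulCommutative ↥T] [IsAlgClosed k] [CharZero k] in
/-- `[𝔤_x, 𝔤_y] ⊆ 𝔤_{x + y}` for weights `x, y ∈ X`. [cite: SpringerLAG1998, 7.1.1] -/
theorem lie_mem_lieWeightSpace_charOfWeight (eX : Additive ↥(characterLattice T) ≃+ X) {x y : X}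
    {A B : Matrix n n k} (hA : A ∈ lieWeightSpace G T (charOfWeight eX x))
    (hB : B ∈ lieWeightSpace G T (charOfWeight eX y)) :
    A * B - B * A ∈ lieWeightSpace G T (charOfWeight eX (x + y)) := by
  refine ⟨lie_mem_lieAlgebraGL hA.1 hB.1, ?_⟩
  rw [charOfWeight_add']
  exact lie_mem_weightSpaceGL hA.2 hB.2

include hG hT in
/-- `[𝔤_x, 𝔤_{-x}] ⊆ Lie(T)`. [folklore] -/
theorem lie_mem_lieAlgebraGL_torus_of_neg {x : X} {A B : Matrix n n k}
    (hA : A ∈ lieWeightSpace G T (charOfWeight eX x)) (hB : B ∈ lieWeightSpace G T (charOfWeight eX (-x))) :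
    A * B - B * A ∈ lieAlgebraGL T := by
  have := lie_mem_lieWeightSpace_charOfWeight eX hA hB
  rw [add_neg_cancel, lieWeightSpace_charOfWeight_zero_eq, lieWeightSpace_one_eq hG hT] at this
  exact this

include hG hT in
/-- **`[𝔤_{α_i}, 𝔤_{-α_i}] = k h_i`**: for `A ∈ 𝔤_{α_i}`, `B ∈ 𝔤_{-α_i}`, `[A, B]` is a multiple of
`h_i`. [cite: Humphreys1972, 8.3] -/
theorem IsRootDatumOf.lie_eq_smul_rootH_of_mem [Infinite k] (i : ι) {A B : Matrix n n k}
    (hA : A ∈ lieWeightSpace G T (charOfWeight eX (P.root i)))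
    (hB : B ∈ lieWeightSpace G T (charOfWeight eX (-P.root i))) :
    ∃ c : k, A * B - B * A = c • h.rootH i := by
  obtain ⟨a, rfl⟩ := (h.mem_lieWeightSpace_root_iff hG hT i).1 hA
  obtain ⟨b, rfl⟩ := (h.mem_lieWeightSpace_neg_root_iff hG hT i).1 hB
  refine ⟨a * b, ?_⟩
  rw [smul_mul_smul_comm, smul_mul_smul_comm, mul_comm b a, ← smul_sub, h.lie_rootE_rootF i]

end Reductive

end Literature.NumberTheory.Automorphic
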